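import Summits.Langlands.Langlands.Theorems.PhantomRMYoshidaResiduallyYoshidaLiftingRealisedCocycleGreenberg
import HarnessLib

/-!
# Route `PhantomRMYoshida`, crux `ResiduallyYoshidaLifting` (stmt-Langlands-13639), line `sector-klingen-split`:
# stub N1⁺ `stub_greenbergStablePlane` — the DECOMPOSITION-GROUP Greenberg condition of a realised cocycle at `p`

Stub-worker file of lead prover-line-stmt-Langlands-13639-c5-0 (skeleton rev 13, sub-goal N1⁺; it strengthens the landed N1
`stub_realisedCocycleGreenberg`, p157554, whose file is imported and is the model).

**Theorem (`stub_greenbergStablePlane`, registered signature verbatim).**  Let `ρ : Γ_ℚ → GL₄(ℚ̄_p)` be an `Sh`-point realising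
the cocycle `B` through the integral frame `(P, rint)` (`rint = P⁻¹ ρ P`) with reduction conjugator `h`
(`red ∘ rint = h (σ̄, B; 0, σ̄') h⁻¹`), on a `DetC` fibre, `p ≠ 2`, `v ∣ p`.  Then there are `x₁ ≠ 0`, `y₁ ≠ 0` and a coboundary
correction `X₀` such that, with `B̃ = B - (σ̄ X₀ - X₀ σ̄')`: the lines `k x₁ ⊆ σ̄`, `k y₁ ⊆ σ̄'` are `G_v`-STABLE and `I_v`-FIXED,
`B̃(τ) y₁ ∈ k x₁` (`τ ∈ G_v`), `B̃(τ) y₁ = 0` and `B̃(τ)(k²) ⊆ k x₁` (`τ ∈ I_v`).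

**Proof.**  (1) `exists_greenbergMatrix`: in the Greenberg frame `g` of `ρ|Γ_{ℚ_v}`, `g ρ(τ) g⁻¹` is block upper triangular,
and `= (1, *; 0, c_τ • 1)` with `c_τ = ε(τ)⁻¹ ∈ ℤ_p` for `τ ∈ I_v`: the plane `M₀ = g⁻¹ (e₀ | e₁)` is `Γ_{ℚ_v}`-STABLE, FIXED by
inertia, and inertia is SCALAR modulo it (`ρ(τ) - c_τ = M₀ W`).  (2) Registered proof: integral frame `M₁ = P⁻¹ M₀`, saturation
`N = M₁ A` (T4 `stub_stablePlaneSaturation`, KEEPING its stability output `rint(τ) N = N T(τ)`); on `I_v`, `rint(τ) N = N` and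
`rint(τ) - c_τ = N W`, `W` integral (rows `i, j` of `N W` are those of `W`).  (3–4) `greenbergStable_of_identityRows`: reduce,
conjugate by `h⁻¹`, transport along `finSumFinEquiv`; then (N1-core extended) `N' = (P; Q)`, `Q c₀ = 0 ≠ c₀`, `Q e ≠ 0` (inertia
moves both constituents), `(c₀, e)` is a BASIS of `k²`, and stability / fixedness / the scalar clause read in the basis
`(x₁, 0), (x₂, y₁)` of the plane give the clauses.  No new definitions, no named fact taken as a hypothesis; Mathlib + the landed
N1 file (through it N1a, T4 and the sibling crux's `exists_mem_absInertia_epsBar_ne_one`, `det_val_eq_of_det_eq`).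
-/

noncomputable section

-- `Summit.Langlands.Langlands.…` (summit = sub-problem name, D-0017 layout) trips `dupNamespace` on every decl.
set_option linter.dupNamespace false
set_option autoImplicit false

open IsDedekindDomain Filter
open scoped Matrix
open Literature.NumberTheory.GaloisRepresentations Literature.NumberTheory.Automorphic
open Summit.Langlands.Langlands.Cruxes.ResiduallyYoshidaLifting.YoshidaDivisorSelmerCount
open Summit.Langlands.Langlands.Cruxes.StableYoshidaCongruence.BurkhardtWeddleTwoThreeAnchor
  (exists_mem_absInertia_epsBar_ne_one det_val_eq_of_det_eq)
open Summit.Langlands.Langlands.Cruxes.ResiduallyYoshidaLifting.EndoscopicCrossingEuler (mem_integer_iff_norm_le_one)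

namespace Summit.Langlands.Langlands.Cruxes.ResiduallyYoshidaLifting.SectorKlingenSplit.Fibre

/-! ### Steps 3–4: reduction of a stable integral plane with an identity block, and the residual linear algebra -/

/-- If a square matrix `T ≠ 1` fixes a square matrix `Q` under left multiplication (`T * Q = Q`), then `Q` is singular:
`Q *ᵥ c = 0` for some `c ≠ 0` (otherwise `T = T Q Q⁻¹ = Q Q⁻¹ = 1`). [folklore] -/
private theorem exists_mulVec_eq_zero_of_mul_eq {k : Type*} [Field k] {n : Type*} [Fintype n] [DecidableEq n]
    (T Q : Matrix n n k) (hT : T ≠ 1) (h : T * Q = Q) : ∃ c : n → k, c ≠ 0 ∧ Q *ᵥ c = 0 := by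
  -- adapted from Theorems/…GreenbergCocycleCore (p156377), private helper of the same name
  by_contra hc
  have hu : IsUnit Q.det := isUnit_iff_ne_zero.mpr fun h0 ↦ by
    obtain ⟨v, hv, hQv⟩ := Matrix.exists_mulVec_eq_zero_iff.mpr h0
    exact hc ⟨v, hv, hQv⟩
  exact hT (calc T = T * Q * Q⁻¹ := (Matrix.mul_nonsing_inv_cancel_right Q T hu).symm
    _ = 1 := by rw [h, Matrix.mul_nonsing_inv Q hu])

/-- **Steps 3–4 (N1-core `stub_greenbergCocycleCore` extended by stability and the scalar clause).**  Let `N : O⁴ˣ²` carry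
an identity `2 × 2` block in rows `i, j`, be STABLE under a family `R t` (`R t * N = N * T t`), and for `t ∈ I` FIXED
(`R t * N = N`) with `R t - c_t = N * W_t`; let the reductions of the `R t` through `red : O → k` be the realised block matrices
`h (S t, B t; 0, S' t) h⁻¹`, with `S t₀ ≠ 1`, `S' t₁ ≠ 1` for some `t₀, t₁ ∈ I`.  Then for suitable `x₁ ≠ 0`, `y₁ ≠ 0`, `X₀` and
`B̃_t = B t - (S t X₀ - X₀ S' t)`: `S t x₁ ∈ k x₁`, `S' t y₁ ∈ k y₁`, `B̃_t y₁ ∈ k x₁` for all `t`, and `S t x₁ = x₁`, `S' t y₁ = y₁`,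
`B̃_t y₁ = 0`, `B̃_t (k²) ⊆ k x₁` for `t ∈ I`.  (Reduce `N`, conjugate by `h⁻¹`, transport along `finSumFinEquiv`: `N' = (P; Q)` of
rank `2`; `Q c₀ = 0 ≠ c₀`, `Q e ≠ 0`, and `(c₀, e)` is a basis of `k²`, so the plane has the basis `(x₁, 0), (x₂, y₁)` with
`x₁ = P c₀`, `x₂ = P e`, `y₁ = Q e`; take `X₀ y₁ = -x₂`.) [folklore] -/
theorem greenbergStable_of_identityRows {O : Type*} [CommRing O] {k : Type*} [Field k] {ι : Type*} (I : ι → Prop) (red : O →+* k)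
    (R : ι → Matrix (Fin 4) (Fin 4) O) (N : Matrix (Fin 4) (Fin 2) O) (i j : Fin 4)
    (hNi0 : N i 0 = 1) (hNi1 : N i 1 = 0) (hNj0 : N j 0 = 0) (hNj1 : N j 1 = 1)
    (hT : ∀ t, ∃ T : Matrix (Fin 2) (Fin 2) O, R t * N = N * T)
    (hI : ∀ t, I t → R t * N = N ∧ ∃ (c : O) (W : Matrix (Fin 2) (Fin 4) O), R t - c • 1 = N * W)
    (h : GL (Fin 4) k) (S S' B : ι → Matrix (Fin 2) (Fin 2) k)
    (hred : ∀ t, (R t).map red =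
      h.val * Matrix.reindex finSumFinEquiv finSumFinEquiv (Matrix.fromBlocks (S t) (B t) 0 (S' t)) * (h⁻¹).val)
    (hS : ∃ t, I t ∧ S t ≠ 1) (hS' : ∃ t, I t ∧ S' t ≠ 1) :
    ∃ (X₀ : Matrix (Fin 2) (Fin 2) k) (x₁ y₁ : Fin 2 → k), x₁ ≠ 0 ∧ y₁ ≠ 0 ∧
      (∀ t, ∃ a : k, S t *ᵥ x₁ = a • x₁) ∧ (∀ t, ∃ b : k, S' t *ᵥ y₁ = b • y₁) ∧
      (∀ t, ∃ c : k, (B t - (S t * X₀ - X₀ * S' t)) *ᵥ y₁ = c • x₁) ∧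
      (∀ t, I t → S t *ᵥ x₁ = x₁) ∧ (∀ t, I t → S' t *ᵥ y₁ = y₁) ∧
      (∀ t, I t → (B t - (S t * X₀ - X₀ * S' t)) *ᵥ y₁ = 0) ∧
      ∀ t, I t → ∀ y : Fin 2 → k, ∃ c : k, (B t - (S t * X₀ - X₀ * S' t)) *ᵥ y = c • x₁ := by
  -- Step 3.  `red N` keeps the identity block, hence has rank `2`
  have hinj : ∀ a : Fin 2 → k, N.map red *ᵥ a = 0 → a = 0 := fun a ha => by
    have hij := And.intro (congrFun ha i) (congrFun ha j)
    simp only [Matrix.mulVec, dotProduct, Fin.sum_univ_two, Matrix.map_apply, hNi0, hNi1, hNj0, hNj1, map_one, map_zero,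
      one_mul, zero_mul, add_zero, zero_add, Pi.zero_apply] at hij
    exact funext fun c => by fin_cases c <;> simp [hij]
  -- the block matrices at the `Fin 4` level, and the conjugation `h⁻¹ (red R t) = F t h⁻¹`
  set eσ : Fin 2 ⊕ Fin 2 ≃ Fin 4 := finSumFinEquiv with heσ
  have hF : ∀ t, (Matrix.reindex eσ eσ (Matrix.fromBlocks (S t) (B t) 0 (S' t))).submatrix eσ eσ =
      Matrix.fromBlocks (S t) (B t) 0 (S' t) := fun t => by
    rw [Matrix.reindex_apply, Matrix.submatrix_submatrix, Equiv.symm_comp_self, Matrix.submatrix_id_id]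
  have hconj : ∀ t, (h⁻¹).val * (R t).map red = Matrix.reindex eσ eσ (Matrix.fromBlocks (S t) (B t) 0 (S' t)) * (h⁻¹).val :=
    fun t => by rw [hred, ← Matrix.mul_assoc, ← Matrix.mul_assoc, Units.inv_mul, Matrix.one_mul]
  -- the residual plane `N' = h⁻¹ (red N)`, transported to `k² ⊕ k²`: stable, fixed on `I`, with the scalar clause on `I`
  obtain ⟨N', hN'⟩ : ∃ N' : Matrix (Fin 2 ⊕ Fin 2) (Fin 2) k, N' = ((h⁻¹).val * N.map red).submatrix eσ id := ⟨_, rfl⟩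
  have hstab' : ∀ t, ∃ T' : Matrix (Fin 2) (Fin 2) k, Matrix.fromBlocks (S t) (B t) 0 (S' t) * N' = N' * T' := fun t => by
    obtain ⟨T, hTt⟩ := hT t
    have e1 : (h⁻¹).val * (R t * N).map red = (h⁻¹).val * (N * T).map red := by rw [hTt]
    rw [Matrix.map_mul, Matrix.map_mul, ← Matrix.mul_assoc, hconj, Matrix.mul_assoc, ← Matrix.mul_assoc (h⁻¹).val] at e1
    refine ⟨T.map red, ?_⟩
    rw [← hF t, hN', Matrix.submatrix_mul_equiv, e1]
    rfl
  have hfix' : ∀ t, I t → Matrix.fromBlocks (S t) (B t) 0 (S' t) * N' = N' := fun t ht => by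
    have e1 : (h⁻¹).val * (R t * N).map red = (h⁻¹).val * N.map red := by rw [(hI t ht).1]
    rw [Matrix.map_mul, ← Matrix.mul_assoc, hconj, Matrix.mul_assoc] at e1
    rw [← hF t, hN', Matrix.submatrix_mul_equiv, e1]
  have hsc' : ∀ t, I t → ∃ (c : k) (W : Matrix (Fin 2) (Fin 2 ⊕ Fin 2) k),
      Matrix.fromBlocks (S t) (B t) 0 (S' t) - c • 1 = N' * W := fun t ht => by
    obtain ⟨c, W, hW⟩ := (hI t ht).2
    have e1 : (h⁻¹).val * (R t - c • 1).map red * h.val = (h⁻¹).val * N.map red * (W.map red * h.val) := by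
      rw [hW, Matrix.map_mul]; simp only [Matrix.mul_assoc]
    rw [Matrix.map_sub _ (map_sub red), Matrix.map_smul' _ _ _ (map_mul red), Matrix.map_one red (map_zero red) (map_one red),
      Matrix.mul_sub, Matrix.sub_mul, hconj, Matrix.mul_assoc, Units.inv_mul, Matrix.mul_one, Matrix.mul_smul, Matrix.mul_one,
      Matrix.smul_mul, Units.inv_mul] at e1
    refine ⟨red c, (W.map red * h.val).submatrix id eσ, ?_⟩
    rw [← hF t, hN', ← Matrix.submatrix_one_equiv eσ]
    exact congrArg (fun X : Matrix (Fin 4) (Fin 4) k => (X.submatrix eσ eσ : Matrix (Fin 2 ⊕ Fin 2) (Fin 2 ⊕ Fin 2) k)) e1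
  have hinj' : ∀ a : Fin 2 → k, N' *ᵥ a = 0 → a = 0 := fun a ha => by
    have h1 : ((h⁻¹).val * N.map red) *ᵥ a = 0 := by
      rw [hN'] at ha
      change (((h⁻¹).val * N.map red) *ᵥ a) ∘ ⇑eσ = 0 at ha
      simpa only [funext_iff, eσ.surjective.forall, Function.comp_apply, Pi.zero_apply] using ha
    refine hinj a ?_
    calc N.map red *ᵥ a = h.val *ᵥ (((h⁻¹).val * N.map red) *ᵥ a) := by
          rw [Matrix.mulVec_mulVec, ← Matrix.mul_assoc, Units.mul_inv, Matrix.one_mul]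
      _ = 0 := by rw [h1, Matrix.mulVec_zero]
  -- Step 4.  `N' = (P; Q)`
  obtain ⟨⟨t₀, hI₀, ht₀⟩, ⟨t₁, hI₁, ht₁⟩⟩ := And.intro hS hS'
  obtain ⟨P, Q, rfl⟩ : ∃ P Q : Matrix (Fin 2) (Fin 2) k, N' = Matrix.fromRows P Q :=
    ⟨N'.toRows₁, N'.toRows₂, (Matrix.fromRows_toRows N').symm⟩
  have hPQ : ∀ a : Fin 2 → k, P *ᵥ a = 0 → Q *ᵥ a = 0 → a = 0 := fun a hPa hQa ↦
    hinj' a (by rw [Matrix.fromRows_mulVec, hPa, hQa, Sum.elim_zero_zero])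
  have hfixPQ : ∀ t, I t → S t * P + B t * Q = P ∧ S' t * Q = Q := fun t ht ↦ by
    simpa only [Matrix.fromBlocks_mul_fromRows, Matrix.fromRows_ext_iff, Matrix.zero_mul, zero_add] using hfix' t ht
  -- `x₁ := P c₀` for `c₀ ≠ 0` with `Q c₀ = 0` (`Q` is singular, being fixed by `S' t₁ ≠ 1`)
  obtain ⟨c₀, hc₀, hQc⟩ := exists_mulVec_eq_zero_of_mul_eq (S' t₁) Q ht₁ (hfixPQ t₁ hI₁).2
  have hx₁ : P *ᵥ c₀ ≠ 0 := fun h0 ↦ hc₀ (hPQ c₀ h0 hQc)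
  -- `Q ≠ 0` (else `S t₀ ≠ 1` would fix the injective `P`): `y₁ := Q e ≠ 0`, `x₂ := P e`
  obtain ⟨e, he⟩ : ∃ e : Fin 2 → k, Q *ᵥ e ≠ 0 := by
    by_contra h0
    push Not at h0
    have hQ0 : Q = 0 := Matrix.ext_iff_mulVec.mpr fun v ↦ by rw [h0 v, Matrix.zero_mulVec]
    obtain ⟨d, hd, hPd⟩ := exists_mulVec_eq_zero_of_mul_eq (S t₀) P ht₀
      (by simpa only [hQ0, Matrix.mul_zero, add_zero] using (hfixPQ t₀ hI₀).1)
    exact hd (hPQ d hPd (by rw [hQ0, Matrix.zero_mulVec]))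
  -- `(c₀, e)` is a basis of `k²`: the plane has the basis `(x₁, 0), (x₂, y₁)`
  have hli : LinearIndependent k ![c₀, e] := by
    refine LinearIndependent.pair_iff.2 fun s s' hst ↦ ?_
    have hQst := congrArg (Q *ᵥ ·) hst
    simp only [Matrix.mulVec_add, Matrix.mulVec_smul, hQc, smul_zero, zero_add, Matrix.mulVec_zero] at hQst
    have hs' : s' = 0 := (smul_eq_zero.1 hQst).resolve_right he
    rw [hs', zero_smul, add_zero] at hst
    exact ⟨(smul_eq_zero.1 hst).resolve_right hc₀, hs'⟩
  have hW : ∀ a : Fin 2 → k, ∃ α β : k,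
      P *ᵥ a = α • (P *ᵥ c₀) + β • (P *ᵥ e) ∧ Q *ᵥ a = β • (Q *ᵥ e) := fun a ↦ by
    let bs := basisOfLinearIndependentOfCardEqFinrank hli (by simp)
    have hb : ⇑bs = ![c₀, e] := coe_basisOfLinearIndependentOfCardEqFinrank _ _
    obtain ⟨α, β, rfl⟩ : ∃ α β : k, a = α • c₀ + β • e :=
      ⟨bs.repr a 0, bs.repr a 1, by conv_lhs => rw [← bs.sum_repr a, Fin.sum_univ_two, hb]; simp⟩
    exact ⟨α, β, by rw [Matrix.mulVec_add, Matrix.mulVec_smul, Matrix.mulVec_smul],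
      by rw [Matrix.mulVec_add, Matrix.mulVec_smul, Matrix.mulVec_smul, hQc, smul_zero, zero_add]⟩
  -- the coboundary matrix: `X₀ y₁ = -x₂`
  obtain ⟨l, hl⟩ : ∃ l, (Q *ᵥ e) l ≠ 0 := by
    by_contra h0
    push Not at h0
    exact he (funext h0)
  obtain ⟨X₀, hX₀⟩ : ∃ X₀ : Matrix (Fin 2) (Fin 2) k, X₀ *ᵥ (Q *ᵥ e) = -(P *ᵥ e) :=
    ⟨Matrix.vecMulVec (-(P *ᵥ e)) (Pi.single l ((Q *ᵥ e) l)⁻¹), by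
      rw [Matrix.vecMulVec_mulVec, single_dotProduct, inv_mul_cancel₀ hl, MulOpposite.op_one, one_smul]⟩
  set x₁ := P *ᵥ c₀
  set x₂ := P *ᵥ e
  set y₁ := Q *ᵥ e
  -- stability read in the basis: `S x₁ = a x₁`, `S' y₁ = b y₁`, `S x₂ + B y₁ = c x₁ + b x₂`
  have hline : ∀ t, ∃ a b c : k,
      S t *ᵥ x₁ = a • x₁ ∧ S' t *ᵥ y₁ = b • y₁ ∧ S t *ᵥ x₂ + B t *ᵥ y₁ = c • x₁ + b • x₂ := fun t ↦ by
    obtain ⟨T, hT2⟩ := hstab' t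
    rw [Matrix.fromBlocks_mul_fromRows, Matrix.fromRows_mul, Matrix.fromRows_ext_iff, Matrix.zero_mul, zero_add] at hT2
    have hP := fun v ↦ congrArg (· *ᵥ v) hT2.1
    have hQ := fun v ↦ congrArg (· *ᵥ v) hT2.2
    simp only [Matrix.add_mulVec, ← Matrix.mulVec_mulVec] at hP hQ
    obtain ⟨⟨α, β, hα, hβ⟩, ⟨α', β', hα', hβ'⟩⟩ := And.intro (hW (T *ᵥ c₀)) (hW (T *ᵥ e))
    have hβ0 : β = 0 := by
      have h0 := hQ c₀
      rw [hQc, Matrix.mulVec_zero, hβ] at h0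
      exact (smul_eq_zero.1 h0.symm).resolve_right he
    refine ⟨α, β', α', ?_, by rw [hQ e, hβ'], by rw [hP e, hα']⟩
    calc S t *ᵥ x₁ = S t *ᵥ x₁ + B t *ᵥ (Q *ᵥ c₀) := by rw [hQc, Matrix.mulVec_zero, add_zero]
      _ = α • x₁ := by rw [hP c₀, hα, hβ0, zero_smul, add_zero]
  -- fixedness read in the basis (the N1 clauses)
  have hIfix : ∀ t, I t → S t *ᵥ x₁ = x₁ ∧ S' t *ᵥ y₁ = y₁ ∧ S t *ᵥ x₂ + B t *ᵥ y₁ = x₂ := fun t ht ↦ by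
    obtain ⟨hP, hQ⟩ := hfixPQ t ht
    refine ⟨?_, by rw [Matrix.mulVec_mulVec, hQ], by rw [Matrix.mulVec_mulVec, Matrix.mulVec_mulVec, ← Matrix.add_mulVec, hP]⟩
    calc S t *ᵥ x₁ = (S t * P + B t * Q) *ᵥ c₀ := by
          rw [Matrix.add_mulVec, ← Matrix.mulVec_mulVec, ← Matrix.mulVec_mulVec, hQc, Matrix.mulVec_zero, add_zero]
      _ = x₁ := by rw [hP]
  -- `B̃ y = B y + X₀ S' y - S X₀ y`
  have hBt : ∀ t y, (B t - (S t * X₀ - X₀ * S' t)) *ᵥ y = B t *ᵥ y + X₀ *ᵥ (S' t *ᵥ y) - S t *ᵥ (X₀ *ᵥ y) := fun t y ↦ by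
    rw [Matrix.sub_mulVec, Matrix.sub_mulVec, ← Matrix.mulVec_mulVec, ← Matrix.mulVec_mulVec, sub_sub_eq_add_sub]
  refine ⟨X₀, x₁, y₁, hx₁, he, fun t ↦ ?_, fun t ↦ ?_, fun t ↦ ?_, fun t ht ↦ (hIfix t ht).1, fun t ht ↦ (hIfix t ht).2.1,
    fun t ht ↦ ?_, fun t ht y ↦ ?_⟩
  · exact let ⟨a, _, _, h1, _, _⟩ := hline t; ⟨a, h1⟩
  · exact let ⟨_, b, _, _, h2, _⟩ := hline t; ⟨b, h2⟩
  · obtain ⟨a, b, c, -, h2, h3⟩ := hline t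
    refine ⟨c, ?_⟩
    rw [hBt, h2, Matrix.mulVec_smul, hX₀, Matrix.mulVec_neg]
    calc B t *ᵥ y₁ + b • -x₂ - -(S t *ᵥ x₂) = S t *ᵥ x₂ + B t *ᵥ y₁ - b • x₂ := by module
      _ = c • x₁ := by rw [h3]; module
  · obtain ⟨-, h2, h3⟩ := hIfix t ht
    rw [hBt, h2, hX₀, Matrix.mulVec_neg]
    calc B t *ᵥ y₁ + -x₂ - -(S t *ᵥ x₂) = S t *ᵥ x₂ + B t *ᵥ y₁ - x₂ := by abel
      _ = 0 := by rw [h3, sub_self]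
  · obtain ⟨c, W, hcW⟩ := hsc' t ht
    rw [sub_eq_iff_eq_add, ← Matrix.fromCols_toCols W, Matrix.fromRows_mul_fromCols, ← Matrix.fromBlocks_one,
      Matrix.fromBlocks_smul, Matrix.fromBlocks_add, Matrix.fromBlocks_inj, smul_zero, add_zero, add_zero] at hcW
    obtain ⟨h11, h12, h21, h22⟩ := hcW
    -- `S t = P W₁ + c`, `B t = P W₂`, `0 = Q W₁`, `S' t = Q W₂ + c`: read them at the coefficient vector `W₂ y - W₁ X₀ y`
    obtain ⟨α, β, hα, hβ⟩ := hW (W.toCols₂ *ᵥ y - W.toCols₁ *ᵥ (X₀ *ᵥ y))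
    rw [Matrix.mulVec_sub, Matrix.mulVec_mulVec, Matrix.mulVec_mulVec] at hα hβ
    rw [← h21, Matrix.zero_mulVec, sub_zero] at hβ
    refine ⟨α, ?_⟩
    rw [hBt, h11, h12, h22, Matrix.add_mulVec, Matrix.add_mulVec, Matrix.smul_mulVec, Matrix.smul_mulVec,
      Matrix.one_mulVec, Matrix.one_mulVec, hβ, Matrix.mulVec_add, Matrix.mulVec_smul, Matrix.mulVec_smul, hX₀]
    calc (P * W.toCols₂) *ᵥ y + (β • -x₂ + c • X₀ *ᵥ y) - ((P * W.toCols₁) *ᵥ (X₀ *ᵥ y) + c • X₀ *ᵥ y)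
        = (P * W.toCols₂) *ᵥ y - (P * W.toCols₁) *ᵥ (X₀ *ᵥ y) - β • x₂ := by module
      _ = α • x₁ := by rw [hα]; module

/-! ### Step 1: the Greenberg frame in matrix form, with the scalar action of inertia modulo the plane -/

/-- **Step 1 (N1a `stub_greenbergPlane` with the scalar clause).**  For `ρ : Γ_K → GL₄(ℚ̄_p)` Greenberg-ordinary of shape
`(0,0,1,1)` with Greenberg frame `g`, the matrix `M₀ = g⁻¹ (e₀ | e₁)` of the Greenberg plane is injective on `ℚ̄_p²`, its plane is
STABLE under every `ρ(τ)` (`ρ(τ) M₀ = M₀ T`) and FIXED by inertia (`ρ(τ) M₀ = M₀`), and inertia is SCALAR modulo the plane: for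
`τ ∈ I_K`, `ρ(τ) - c • 1 = M₀ W` with `c = ε(τ)⁻¹ ∈ ℤ̄_p` (in the frame, `g ρ(τ) g⁻¹ = (1, *; 0, c • 1)` by clauses 2–3 of the
shape). [folklore] -/
theorem exists_greenbergMatrix {p : ℕ} [Fact p.Prime] {K : Type} [Field K] [ValuativeRel K] [TopologicalSpace K]
    [IsNonarchimedeanLocalField K] (ρ : FramedRep (Field.absoluteGaloisGroup K) (PadicAlgCl p) 4)
    (hρ : ρ.IsGreenbergOrdinaryOfShape ![0, 0, 1, 1]) :
    ∃ M₀ : Matrix (Fin 4) (Fin 2) (PadicAlgCl p), (∀ a : Fin 2 → PadicAlgCl p, M₀ *ᵥ a = 0 → a = 0) ∧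
      (∀ τ, ∃ T : Matrix (Fin 2) (Fin 2) (PadicAlgCl p), (ρ τ).val * M₀ = M₀ * T) ∧
      ∀ τ ∈ absInertia K, (ρ τ).val * M₀ = M₀ ∧ ∃ c ∈ Valued.integer (PadicAlgCl p),
        ∃ W : Matrix (Fin 2) (Fin 4) (PadicAlgCl p), (ρ τ).val - c • 1 = M₀ * W := by
  obtain ⟨g, hup, hdiag, hoff⟩ := hρ
  -- `M τ = g ρ(τ) g⁻¹`, `ρ(τ) = g⁻¹ M(τ) g`; `E = (e₀ | e₁)`, `M₀ = g⁻¹ E`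
  obtain ⟨M, hM⟩ : ∃ M : Field.absoluteGaloisGroup K → Matrix (Fin 4) (Fin 4) (PadicAlgCl p),
      ∀ τ, M τ = ((g * ρ τ * g⁻¹ : GL (Fin 4) (PadicAlgCl p)) : Matrix (Fin 4) (Fin 4) (PadicAlgCl p)) := ⟨_, fun τ => rfl⟩
  have hρM : ∀ τ, (ρ τ).val = (g⁻¹).val * M τ * g.val := fun τ => by
    rw [hM, ← Units.val_mul, ← Units.val_mul, ← mul_assoc, ← mul_assoc, inv_mul_cancel, one_mul, inv_mul_cancel_right]
  have hlow : ∀ τ (r s : Fin 4), s < r → M τ r s = 0 := fun τ r s hrs => by rw [hM]; exact hup τ r s hrs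
  set E : Matrix (Fin 4) (Fin 2) (PadicAlgCl p) := !![1, 0; 0, 1; 0, 0; 0, 0] with hE
  have hgE : ∀ X : Matrix (Fin 4) (Fin 4) (PadicAlgCl p), (g⁻¹).val * X * g.val * ((g⁻¹).val * E) = (g⁻¹).val * (X * E) :=
    fun X => by rw [Matrix.mul_assoc, ← Matrix.mul_assoc g.val, Units.mul_inv, Matrix.one_mul, Matrix.mul_assoc]
  refine ⟨(g⁻¹).val * E, fun a ha => ?_, fun τ => ?_, fun τ hτ => ?_⟩
  · have hEa : E *ᵥ a = 0 := by
      simpa only [Matrix.mulVec_mulVec, ← Matrix.mul_assoc, Units.mul_inv, Matrix.one_mul, Matrix.mulVec_zero]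
        using congrArg (g.val *ᵥ ·) ha
    have h0 : a 0 = 0 := by simpa [hE, Matrix.mulVec, dotProduct, Fin.sum_univ_two] using congrFun hEa 0
    have h1 : a 1 = 0 := by simpa [hE, Matrix.mulVec, dotProduct, Fin.sum_univ_two] using congrFun hEa 1
    exact funext fun c => by fin_cases c <;> assumption
  · -- the lower-left block of `M τ` vanishes: `M τ E = E T` for the top-left block `T`
    refine ⟨!![M τ 0 0, M τ 0 1; M τ 1 0, M τ 1 1], ?_⟩
    have hME : M τ * E = E * !![M τ 0 0, M τ 0 1; M τ 1 0, M τ 1 1] := by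
      ext r c
      fin_cases r <;> fin_cases c <;> simp [hE, Matrix.mul_apply, Fin.sum_univ_four, Fin.sum_univ_two,
        hlow τ 2 0 (by decide), hlow τ 2 1 (by decide), hlow τ 3 0 (by decide), hlow τ 3 1 (by decide)]
    rw [hρM, hgE, hME, ← Matrix.mul_assoc]
  · -- `τ ∈ I_K`: `M τ = (1, *; 0, c • 1)` with `c = ε(τ)⁻¹ ∈ ℤ_p`
    obtain ⟨c, hc⟩ : ∃ c : PadicAlgCl p,
        c = algebraMap ℚ_[p] (PadicAlgCl p) ((((GaloisRep.cyclotomicCharacter K p τ)⁻¹ : ℤ_[p]ˣ) : ℤ_[p]) : ℚ_[p]) := ⟨_, rfl⟩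
    obtain ⟨h00, h11, h22, h33⟩ : M τ 0 0 = 1 ∧ M τ 1 1 = 1 ∧ M τ 2 2 = c ∧ M τ 3 3 = c := by
      refine ⟨?_, ?_, ?_, ?_⟩ <;> rw [hM, hdiag τ hτ] <;> simp [hc]
    have h01 : M τ 0 1 = 0 := by rw [hM]; exact hoff τ hτ 0 1 (by decide) (by simp)
    have h23 : M τ 2 3 = 0 := by rw [hM]; exact hoff τ hτ 2 3 (by decide) (by simp)
    constructor
    · have hME : M τ * E = E := by
        ext r c
        fin_cases r <;> fin_cases c <;> simp [hE, Matrix.mul_apply, Fin.sum_univ_four, h00, h11, h01, hlow τ 1 0 (by decide),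
          hlow τ 2 0 (by decide), hlow τ 2 1 (by decide), hlow τ 3 0 (by decide), hlow τ 3 1 (by decide)]
      rw [hρM, hgE, hME]
    · -- the two bottom rows of `M τ - c • 1` vanish: `M τ - c • 1 = E W₀` with `W₀` its two top rows
      obtain ⟨W₀, hW₀⟩ : ∃ W₀ : Matrix (Fin 2) (Fin 4) (PadicAlgCl p),
          W₀ = Matrix.of fun (a : Fin 2) s => (M τ - c • 1) (![0, 1] a) s := ⟨_, rfl⟩
      have hMc : M τ - c • 1 = E * W₀ := by
        rw [hW₀]
        ext r s
        fin_cases r <;> fin_cases s <;> simp [hE, Matrix.mul_apply, Fin.sum_univ_two, Matrix.one_apply, h22, h23, h33,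
          hlow τ 2 0 (by decide), hlow τ 2 1 (by decide), hlow τ 3 0 (by decide), hlow τ 3 1 (by decide), hlow τ 3 2 (by decide)]
      refine ⟨c, ?_, W₀ * g.val, ?_⟩
      · rw [hc, mem_integer_iff_norm_le_one, norm_algebraMap']
        exact PadicInt.norm_le_one _
      · calc (ρ τ).val - c • 1 = (g⁻¹).val * (M τ - c • 1) * g.val := by
              rw [Matrix.mul_sub, Matrix.sub_mul, Matrix.mul_smul, Matrix.mul_one, Matrix.smul_mul, Units.inv_mul, hρM]
          _ = (g⁻¹).val * E * (W₀ * g.val) := by rw [hMc]; simp only [Matrix.mul_assoc]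

/-! ### Registered form -/

/-- **Registered sub-goal N1⁺ `stub_greenbergStablePlane`** (crux stmt-Langlands-13639, line `sector-klingen-split`, skeleton
rev 13; the DECOMPOSITION-GROUP Greenberg condition of the realised class, strengthening N1 p157554): for an `Sh`-point `ρ`
realising `B` through the integral frame `(P, rint)` with reduction conjugator `h`, on a `DetC` fibre (`p ≠ 2`), at `v ∣ p`, there
are lines `k x₁ ⊆ σ̄`, `k y₁ ⊆ σ̄'` STABLE under `G_v` and FIXED by `I_v`, and a coboundary correction `X₀`, such that `B̃ = B - δX₀`
maps `y₁` into `k x₁` on `G_v`, kills `y₁` on `I_v`, and maps all of `σ̄'` into `k x₁` on `I_v` (Greenberg frame with inertia scalar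
modulo the plane, integral frame, saturation by T4 keeping stability, `greenbergStable_of_identityRows`, `ε̄(τ₀) ≠ 1`). [folklore] -/
theorem stub_greenbergStablePlane :
    ∀ (p : ℕ) [Fact p.Prime], p ≠ 2 → ∀ (k : Type) [Field k] [CharP k p] [IsAlgClosed k]
      [TopologicalSpace k] [DiscreteTopology k] (red : Valued.integer (PadicAlgCl p) →+* k)
      (σ σ' : FramedGaloisRep ℚ k 2) (ρ : FramedGaloisRep ℚ (PadicAlgCl p) 4)
      (P : GL (Fin 4) (PadicAlgCl p))
      (rint : Field.absoluteGaloisGroup ℚ →* GL (Fin 4) (Valued.integer (PadicAlgCl p))) (h : GL (Fin 4) k)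
      (B : Field.absoluteGaloisGroup ℚ → Matrix (Fin 2) (Fin 2) k)
      (v : HeightOneSpectrum (NumberField.RingOfIntegers ℚ)),
      ((p : ℕ) : NumberField.RingOfIntegers ℚ) ∈ v.asIdeal → DetC p k σ σ' → Sh p k red σ σ' ρ →
      (∀ g, Matrix.GeneralLinearGroup.map (Valued.integer (PadicAlgCl p)).subtype (rint g) = P⁻¹ * ρ g * P) →
      (∀ g, (Matrix.GeneralLinearGroup.map red (rint g)).val =
          h.val * Matrix.reindex finSumFinEquiv finSumFinEquiv
            (Matrix.fromBlocks (σ g).val (B g) 0 (σ' g).val) * (h⁻¹).val) →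
      ∃ (X₀ : Matrix (Fin 2) (Fin 2) k) (x₁ y₁ : Fin 2 → k), x₁ ≠ 0 ∧ y₁ ≠ 0 ∧
        (∀ τ : Field.absoluteGaloisGroup (v.adicCompletion ℚ), ∃ a : k,
          (σ (absGaloisRestrict ℚ (v.adicCompletion ℚ) τ)).val *ᵥ x₁ = a • x₁) ∧
        (∀ τ : Field.absoluteGaloisGroup (v.adicCompletion ℚ), ∃ b : k,
          (σ' (absGaloisRestrict ℚ (v.adicCompletion ℚ) τ)).val *ᵥ y₁ = b • y₁) ∧
        (∀ τ : Field.absoluteGaloisGroup (v.adicCompletion ℚ), ∃ c : k,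
          (B (absGaloisRestrict ℚ (v.adicCompletion ℚ) τ) -
            ((σ (absGaloisRestrict ℚ (v.adicCompletion ℚ) τ)).val * X₀ -
              X₀ * (σ' (absGaloisRestrict ℚ (v.adicCompletion ℚ) τ)).val)) *ᵥ y₁ = c • x₁) ∧
        (∀ τ ∈ absInertia (v.adicCompletion ℚ),
          (σ (absGaloisRestrict ℚ (v.adicCompletion ℚ) τ)).val *ᵥ x₁ = x₁) ∧
        (∀ τ ∈ absInertia (v.adicCompletion ℚ),
          (σ' (absGaloisRestrict ℚ (v.adicCompletion ℚ) τ)).val *ᵥ y₁ = y₁) ∧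
        (∀ τ ∈ absInertia (v.adicCompletion ℚ),
          (B (absGaloisRestrict ℚ (v.adicCompletion ℚ) τ) -
            ((σ (absGaloisRestrict ℚ (v.adicCompletion ℚ) τ)).val * X₀ -
              X₀ * (σ' (absGaloisRestrict ℚ (v.adicCompletion ℚ) τ)).val)) *ᵥ y₁ = 0) ∧
        ∀ τ ∈ absInertia (v.adicCompletion ℚ), ∀ y : Fin 2 → k, ∃ c : k,
          (B (absGaloisRestrict ℚ (v.adicCompletion ℚ) τ) -
            ((σ (absGaloisRestrict ℚ (v.adicCompletion ℚ) τ)).val * X₀ -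
              X₀ * (σ' (absGaloisRestrict ℚ (v.adicCompletion ℚ) τ)).val)) *ᵥ y = c • x₁ := by
  intro p _ hp k _ _ _ _ _ red σ σ' ρ P rint h B v hv hDet hSh hP hred
  -- the integral frame over `ℚ̄_p`, as a plain matrix family; `L` = restriction to `Γ_{ℚ_v}`
  have hPval : ∀ g, (rint g).val.map (Valued.integer (PadicAlgCl p)).subtype = (P⁻¹).val * (ρ g).val * P.val := fun g => by
    have e := congrArg Units.val (hP g)
    rwa [Units.val_mul, Units.val_mul] at e
  set L := absGaloisRestrict ℚ (v.adicCompletion ℚ) with hL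
  -- Step 1 for `ρ|Γ_{ℚ_v}` (Greenberg-ordinary of shape `(0,0,1,1)` by `Sh`)
  obtain ⟨M₀, hM₀inj, hM₀stab, hM₀I⟩ := exists_greenbergMatrix (ρ.toLocal v) (hSh.2.1 v hv).1
  -- Step 2: the plane of the integral frame, `M₁ := P⁻¹ M₀`, saturated over `ℤ̄_p` (T4, keeping stability)
  obtain ⟨M₁, hM₁⟩ : ∃ M₁ : Matrix (Fin 4) (Fin 2) (PadicAlgCl p), M₁ = (P⁻¹).val * M₀ := ⟨_, rfl⟩
  have hinj : ∀ a : Fin 2 → PadicAlgCl p, M₁ *ᵥ a = 0 → a = 0 := fun a ha => hM₀inj a <| by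
    calc M₀ *ᵥ a = P.val *ᵥ (M₁ *ᵥ a) := by rw [hM₁, Matrix.mulVec_mulVec, ← Matrix.mul_assoc, Units.mul_inv, Matrix.one_mul]
      _ = 0 := by rw [ha, Matrix.mulVec_zero]
  have hact : ∀ τ, (rint (L τ)).val.map (Valued.integer (PadicAlgCl p)).subtype * M₁ = (P⁻¹).val * ((ρ.toLocal v τ).val * M₀) :=
    fun τ => by rw [hPval, hM₁, Matrix.mul_assoc, ← Matrix.mul_assoc P.val, Units.mul_inv, Matrix.one_mul, Matrix.mul_assoc]; rfl
  have hstab : ∀ τ, ∃ T : Matrix (Fin 2) (Fin 2) (PadicAlgCl p), (rint (L τ)).val.map (Valued.integer (PadicAlgCl p)).subtype * M₁ =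
      M₁ * T := fun τ => (hM₀stab τ).imp fun T hT => by rw [hact τ, hT, hM₁, Matrix.mul_assoc]
  obtain ⟨N, A, i, j, T, -, hNi0, hNi1, hNj0, hNj1, hA, hNA, hNT⟩ :=
    stub_stablePlaneSaturation p (Field.absoluteGaloisGroup (v.adicCompletion ℚ)) (fun τ => (rint (L τ)).val) M₁ hinj hstab
  -- inertia: `rint τ * N = N` and `rint τ - c = N * W` over `ℤ̄_p` (rows `i, j` of `N * W` are the rows of `W`)
  have key : ∀ X : Matrix (Fin 2) (Fin 4) (PadicAlgCl p),
      Matrix.of (fun a s => (N.map (Valued.integer (PadicAlgCl p)).subtype * X) (![i, j] a) s) = X := fun X => by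
    ext a s
    fin_cases a <;> simp [Matrix.mul_apply, Fin.sum_univ_two, hNi0, hNi1, hNj0, hNj1]
  have hI : ∀ τ ∈ absInertia (v.adicCompletion ℚ), (rint (L τ)).val * N = N ∧
      ∃ (c : Valued.integer (PadicAlgCl p)) (W : Matrix (Fin 2) (Fin 4) (Valued.integer (PadicAlgCl p))),
        (rint (L τ)).val - c • 1 = N * W := fun τ hτ => by
    obtain ⟨hfixτ, c, hc, W, hW⟩ := hM₀I τ hτ
    constructor
    · apply Matrix.map_injective (Valued.integer (PadicAlgCl p)).subtype_injective
      show ((rint (L τ)).val * N).map _ = N.map _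
      rw [Matrix.map_mul, hNA, ← Matrix.mul_assoc, hact τ, hfixτ, hM₁]
    · -- over `ℚ̄_p`: `rint τ - c = P⁻¹ (ρ τ - c) P = M₁ W P = N (A⁻¹ W P)`; rows `i, j` make the coefficient matrix integral
      set X : Matrix (Fin 4) (Fin 4) (Valued.integer (PadicAlgCl p)) := (rint (L τ)).val - (⟨c, hc⟩ : Valued.integer (PadicAlgCl p)) • 1
        with hX
      have e1 : X.map (Valued.integer (PadicAlgCl p)).subtype = N.map (Valued.integer (PadicAlgCl p)).subtype * (A⁻¹ * W * P.val) := by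
        rw [hX, Matrix.map_sub _ (map_sub _), Matrix.map_smul' _ _ _ (map_mul _), Matrix.map_one _ (map_zero _) (map_one _), hPval,
          hNA, hM₁, show (ρ (L τ)).val = M₀ * W + c • 1 from sub_eq_iff_eq_add.1 hW, Matrix.mul_add, Matrix.add_mul, Matrix.mul_smul,
          Matrix.mul_one, Matrix.smul_mul, Units.inv_mul]
        show _ + c • (1 : Matrix (Fin 4) (Fin 4) (PadicAlgCl p)) - c • 1 = _
        rw [add_sub_cancel_right]
        simp only [Matrix.mul_assoc]
        rw [Matrix.mul_nonsing_inv_cancel_left A _ hA]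
      refine ⟨⟨c, hc⟩, Matrix.of fun a s => X (![i, j] a) s, Matrix.map_injective (Valued.integer (PadicAlgCl p)).subtype_injective ?_⟩
      show X.map _ = (N * Matrix.of fun a s => X (![i, j] a) s).map _
      rw [Matrix.map_mul, e1, ← key (A⁻¹ * W * P.val), ← e1]
      rfl
  -- Step 4 input: an inertia element `τ₀` with `ε̄(τ₀) ≠ 1` moves both constituents (`det = ε̄⁻¹`)
  obtain ⟨τ₀, hτ₀I, hτ₀⟩ := exists_mem_absInertia_epsBar_ne_one hp v hv
  have hmove : ∀ s : FramedGaloisRep ℚ k 2,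
      (∀ g, FramedRep.det s g = (Units.map (ZMod.castHom (dvd_refl p) k).toMonoidHom (εb p g))⁻¹) → (s (L τ₀)).val ≠ 1 :=
      fun s hs h1 => by
    have h2 := det_val_eq_of_det_eq (hs (L τ₀))
    rw [h1, Matrix.det_one, eq_comm, map_eq_one_iff _ (ZMod.castHom_injective k), Units.val_eq_one, inv_eq_one] at h2
    exact hτ₀ h2
  -- Steps 3–4 over `Γ_{ℚ_v}` with the inertia predicate
  exact greenbergStable_of_identityRows (fun τ => τ ∈ absInertia (v.adicCompletion ℚ)) red (fun τ => (rint (L τ)).val) N i j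
    hNi0 hNi1 hNj0 hNj1 (fun τ => ⟨T τ, hNT τ⟩) hI h (fun τ => (σ (L τ)).val) (fun τ => (σ' (L τ)).val) (fun τ => B (L τ))
    (fun τ => hred _) ⟨τ₀, hτ₀I, hmove σ fun g => (hDet g).1⟩ ⟨τ₀, hτ₀I, hmove σ' fun g => (hDet g).2.trans (hDet g).1⟩

end Summit.Langlands.Langlands.Cruxes.ResiduallyYoshidaLifting.SectorKlingenSplit.Fibre

end
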